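import Summits.Parity.GeneralizedHardyLittlewood.Theorems.BeyondDiagonalBeatsQuarter.OffDiagPoissonApplied
import HarnessLib

/-!
# Route `PrimeLevelFamEdge`, crux K_B (stmt-Parity-20343), line `diagonal_kernel_split` rev 4, plan Ω —
# **the dual multiplicity on the NON-COPRIME strata: `N_c(a,β;h₁,h₂) ≤ gcd(a,c)`, and `= 0` unless `gcd(a,c) ∣ h₁`**

`OffDiag.dualCount c α β h₁ h₂ = #{u ∈ (ℤ/c)ˣ : αu + h₁ = 0 ∧ βū + h₂ = 0}` is `≤ 1` when `α` is a unit
(`OffDiag.dualCount_le_one`; W-a `OffDiagDual.dualCount_eq_ite_of_isUnit`). In the heart's layers `c = q(r+1)`,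
`α = l/d₁ ∈ [1,q)`, so `α` is a unit iff `(l/d₁, r+1) = 1`; on the complementary strata (a positive proportion of the
`r ≤ q⁷`) the trivial ledger (OMEGA-BLUEPRINT L3) needs the sharper finite count recorded here (referee ls-ref-1 g18 FLAG,
STATUS 2026-08-28T13:54Z):

* `card_filter_natCast_mul_eq_zero_le_gcd` — `#{y ∈ ℤ/c : a·y = 0} ≤ gcd(a,c)` (such `y` are the multiples of `c/gcd(a,c)`);
* `card_filter_natCast_mul_eq_le_gcd` — `#{x ∈ ℤ/c : a·x = t} ≤ gcd(a,c)` for every `t` (a translate of the former, or empty);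
* **`dualCount_natCast_le_gcd`** — `N_c(a,β;h₁,h₂) ≤ gcd(a,c)`;
* **`dualCount_natCast_eq_zero_of_not_dvd`** — if `gcd(a,c) ∤ h₁` (as an integer) then `N_c(a,β;h₁,h₂) = 0`.

Finite algebra over `ZMod`; theorems only; standard axioms. Helper toward `stub_offDiagBelowSlack_io`; closes nothing.
«The programme SEARCHES and TYPES; no claim about Landau–Siegel zeros, Theorems 1–2 of arXiv:2211.02515 or
a repaired Margin232 until a kernel theorem says so.»
-/

namespace Summit.Parity.GeneralizedHardyLittlewood.Theorems.BeyondDiagonalBeatsQuarter.OffDiag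

open Finset

variable {c : ℕ} [NeZero c]

/-- If `a·y = 0` in `ℤ/c` then `c/gcd(a,c)` divides `y.val`. [folklore] -/
theorem div_gcd_dvd_val_of_mul_eq_zero {a : ℕ} {y : ZMod c} (h : (a : ZMod c) * y = 0) :
    c / Nat.gcd a c ∣ y.val := by
  have hc0 : c ≠ 0 := NeZero.ne c
  -- `c ∣ a * y.val`
  have hdvd : c ∣ a * y.val := by
    rw [← ZMod.natCast_eq_zero_iff, Nat.cast_mul, ZMod.natCast_zmod_val]
    exact h
  set g := Nat.gcd a c with hg
  have hg0 : 0 < g := Nat.gcd_pos_of_pos_right a (Nat.pos_of_ne_zero hc0)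
  obtain ⟨a', ha'⟩ := Nat.gcd_dvd_left a c
  obtain ⟨c', hc'⟩ := Nat.gcd_dvd_right a c
  rw [← hg] at ha' hc'
  have hcop : Nat.Coprime c' a' := by
    have := Nat.coprime_div_gcd_div_gcd (m := a) (n := c) hg0
    rw [← hg] at this
    have e1 : a / g = a' := by rw [ha', Nat.mul_div_cancel_left _ hg0]
    have e2 : c / g = c' := by rw [hc', Nat.mul_div_cancel_left _ hg0]
    rw [e1, e2] at this
    exact this.symm
  have hcdiv : c / g = c' := by rw [hc', Nat.mul_div_cancel_left _ hg0]
  obtain ⟨v, hv⟩ : ∃ v : ℕ, v = y.val := ⟨_, rfl⟩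
  rw [← hv] at hdvd ⊢
  rw [hcdiv]
  -- from `g c' ∣ g a' v` get `c' ∣ a' v`, then `c' ∣ v`
  rw [ha', hc', mul_assoc] at hdvd
  have h2 : c' ∣ a' * v := Nat.dvd_of_mul_dvd_mul_left hg0 hdvd
  exact hcop.dvd_of_dvd_mul_left h2

/-- **`#{y ∈ ℤ/c : a·y = 0} ≤ gcd(a,c)`**: such `y` have `y.val = k·(c/gcd)` with `k < gcd`. [folklore] -/
theorem card_filter_natCast_mul_eq_zero_le_gcd (a : ℕ) :
    ((univ : Finset (ZMod c)).filter (fun y : ZMod c ↦ (a : ZMod c) * y = 0)).card ≤ Nat.gcd a c := by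
  have hc0 : c ≠ 0 := NeZero.ne c
  set g := Nat.gcd a c with hg
  have hg0 : 0 < g := Nat.gcd_pos_of_pos_right a (Nat.pos_of_ne_zero hc0)
  have hgc : g ∣ c := Nat.gcd_dvd_right a c
  set d := c / g with hd
  have hd0 : 0 < d := Nat.div_pos (Nat.le_of_dvd (Nat.pos_of_ne_zero hc0) hgc) hg0
  have hcd : c = d * g := by rw [hd, Nat.div_mul_cancel hgc]
  -- inject into `range g` by `y ↦ y.val / d`
  calc ((univ : Finset (ZMod c)).filter (fun y : ZMod c ↦ (a : ZMod c) * y = 0)).card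
      ≤ (Finset.range g).card := by
        refine Finset.card_le_card_of_injOn (fun y : ZMod c ↦ y.val / d) (fun y hy ↦ ?_) ?_
        · rw [Finset.mem_coe, Finset.mem_filter] at hy
          rw [Finset.mem_coe, Finset.mem_range]
          have hv : y.val < d * g := lt_of_lt_of_eq (ZMod.val_lt y) hcd
          exact Nat.div_lt_of_lt_mul hv
        · intro y hy y' hy' hyy'
          rw [Finset.mem_coe, Finset.mem_filter] at hy hy'
          have h1 := div_gcd_dvd_val_of_mul_eq_zero hy.2
          have h2 := div_gcd_dvd_val_of_mul_eq_zero hy'.2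
          rw [← hg, ← hd] at h1 h2
          simp only at hyy'
          have : y.val = y'.val := by
            rw [← Nat.div_mul_cancel h1, ← Nat.div_mul_cancel h2, hyy']
          exact ZMod.val_injective c this
    _ = g := Finset.card_range g

/-- **`#{x ∈ ℤ/c : a·x = t} ≤ gcd(a,c)`** for every `t` (empty, or a translate of the solution set of `a·y = 0`). [folklore] -/
theorem card_filter_natCast_mul_eq_le_gcd (a : ℕ) (t : ZMod c) :
    ((univ : Finset (ZMod c)).filter (fun x : ZMod c ↦ (a : ZMod c) * x = t)).card ≤ Nat.gcd a c := by
  by_cases hne : ((univ : Finset (ZMod c)).filter (fun x : ZMod c ↦ (a : ZMod c) * x = t)).Nonempty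
  · obtain ⟨x₀, hx₀⟩ := hne
    rw [Finset.mem_filter] at hx₀
    calc ((univ : Finset (ZMod c)).filter (fun x : ZMod c ↦ (a : ZMod c) * x = t)).card
        ≤ ((univ : Finset (ZMod c)).filter (fun y : ZMod c ↦ (a : ZMod c) * y = 0)).card := by
          refine Finset.card_le_card_of_injOn (fun x : ZMod c ↦ x - x₀) (fun x hx ↦ ?_)
            (fun x _ x' _ h ↦ by simpa using h)
          rw [Finset.mem_coe, Finset.mem_filter] at hx
          rw [Finset.mem_coe, Finset.mem_filter]
          exact ⟨Finset.mem_univ _, by rw [mul_sub, hx.2, hx₀.2, sub_self]⟩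
      _ ≤ Nat.gcd a c := card_filter_natCast_mul_eq_zero_le_gcd a
  · rw [Finset.not_nonempty_iff_eq_empty.mp hne, Finset.card_empty]
    exact Nat.zero_le _

/-- **The dual multiplicity on every stratum: `N_c(a,β;h₁,h₂) ≤ gcd(a,c)`** (the units `u` with `a·u = −h₁` inject into
the solutions `x ∈ ℤ/c` of `a·x = −h₁`). [folklore] -/
theorem dualCount_natCast_le_gcd (a : ℕ) (β h₁ h₂ : ZMod c) :
    dualCount c (a : ZMod c) β h₁ h₂ ≤ Nat.gcd a c := by
  rw [dualCount]
  calc _ ≤ ((univ : Finset (ZMod c)).filter (fun x : ZMod c ↦ (a : ZMod c) * x = -h₁)).card := by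
        refine Finset.card_le_card_of_injOn (fun u : (ZMod c)ˣ ↦ (u : ZMod c)) (fun u hu ↦ ?_)
          (fun u _ v _ h ↦ Units.ext h)
        rw [Finset.mem_coe, Finset.mem_filter] at hu
        rw [Finset.mem_coe, Finset.mem_filter]
        exact ⟨Finset.mem_univ _, eq_neg_of_add_eq_zero_left hu.2.1⟩
    _ ≤ Nat.gcd a c := card_filter_natCast_mul_eq_le_gcd a (-h₁)

/-- If `a·u + h₁ = 0` in `ℤ/c` for some `u`, then `gcd(a,c) ∣ h₁.val`. [folklore] -/
theorem gcd_dvd_val_of_mul_add_eq_zero {a : ℕ} {u h₁ : ZMod c} (h : (a : ZMod c) * u + h₁ = 0) :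
    Nat.gcd a c ∣ h₁.val := by
  set g := Nat.gcd a c with hg
  have hgc : g ∣ c := Nat.gcd_dvd_right a c
  have hga : g ∣ a := Nat.gcd_dvd_left a c
  -- push the identity to `ZMod g`
  have h' := congrArg (ZMod.castHom hgc (ZMod g)) h
  rw [map_add, map_mul, map_natCast, map_zero, (ZMod.natCast_eq_zero_iff a g).mpr hga, zero_mul,
    zero_add] at h'
  rw [← ZMod.natCast_eq_zero_iff]
  have : (ZMod.castHom hgc (ZMod g)) h₁ = ((h₁.val : ℕ) : ZMod g) := by
    rw [← ZMod.natCast_zmod_val h₁, map_natCast, ZMod.natCast_zmod_val]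
  rw [← this]
  exact h'

/-- **Off the divisibility `gcd(a,c) ∣ h₁` the multiplicity vanishes**: `N_c(a,β;h₁,h₂) = 0`. [folklore] -/
theorem dualCount_natCast_eq_zero_of_not_dvd {a : ℕ} {h₁ : ZMod c} (hnd : ¬ Nat.gcd a c ∣ h₁.val)
    (β h₂ : ZMod c) : dualCount c (a : ZMod c) β h₁ h₂ = 0 := by
  rw [dualCount, Finset.card_eq_zero]
  exact Finset.filter_false_of_mem fun u _ hu ↦ hnd (gcd_dvd_val_of_mul_add_eq_zero hu.1)

end Summit.Parity.GeneralizedHardyLittlewood.Theorems.BeyondDiagonalBeatsQuarter.OffDiag
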